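import Literature.NumberTheory.EllipticCurves.Sprung2012.SharpFlatSelmerDualExistsProofs
import Literature.NumberTheory.EllipticCurves.Kato2004.IwasawaInvolutionTwistProofs
import Literature.NumberTheory.EllipticCurves.IwasawaAlgebraInvolutionInvariantsProofs
import HarnessLib

/-!
# `X^•(E/K_∞)` is UNIQUE up to `Λ`-isomorphism at every key `γ`, and its `γ ↦ γ⁻¹` re-keying is the
# Iwasawa-involution twist `M ↦ M^ι`: the ♯/♭ twin of the fine dictionary (proofs only; 0 def, 0 fact)

Topic `NumberTheory/EllipticCurves`, cluster `Sprung2012` (namespace = path). Sibling PROOF file of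
`Sprung2012/SharpFlatSelmer.lean` (the hypothesis structure `SharpFlatSelmerDualData W κ γ ι ap g c •` =
Sprung's `X^•(E/K_∞) := Hom(Sel^•(E/K_∞), ℚ_p/ℤ_p)`, J. Number Theory **132** (2012) Def. 7.11 [Sprung2012])
and of `Sprung2012/SharpFlatSelmerDualExistsProofs.lean` (existence at every key; the endomorphism
`conjSharpFlatSelmerInfty` and its local nilpotence `isLocNil_conjSharpFlatSelmerInfty_sub_one'`). It is the
♯/♭ copy, token for token, of two landed fine-Selmer files:
`KatoFineSelmerDualUniquenessProofs.lean` (`FineSelmerDualData.toDual_smul`, `exists_linearEquiv`,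
`nonempty_linearEquiv`) and `Kato2004/IwasawaInvolutionTwistProofs.lean` §3
(`fineSelmerDualData_exists_involTwist`, `fineSelmerDualData_lengthAt_inv_eq`). THEOREMS ONLY: no
definition, no named fact, no `instance`, no notation, no `sorry`; nothing about Sprung's Thm. 7.14 / 7.16,
his Main Conjecture 7.21 or BSD is asserted.

## Why (the two `Λ`-conventions, and why the ♯/♭ dictionary is wanted)

`SharpFlatSelmerDualData.toDual_T_smul` lets `T` act on `X^• = Hom(Sel^•(E/K_∞), ℚ/ℤ)` by PRE-composition,
`(T·x)(s) = x(conj_γ s) − x(s)`: `1 + T` acts as `x ↦ x ∘ conj_γ`, which is the CONTRAGREDIENT action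
`x ↦ x ∘ conj_{δ⁻¹}` of `δ = γ⁻¹`. Poitou–Tate / Tate local duality, being induced by a Galois-invariant
pairing, is `Λ`-linear between the covariant `𝐇¹` (on which the tree's `SharpFlatColemanKatoData` and the Coleman
maps live, `1 + T ↦ γ`) and the contragredient duals; so, with `1 + T ↦ γ` on both sides, the dual of print
(Sprung's sequence (3) p. 1486 / Thm. 7.14 (3) / Main Conj. 7.21) is the datum of key `γ⁻¹`,
`SharpFlatSelmerDualData W κ γ⁻¹ …`, while the datum of key `γ` is its twist `(X^•)^ι` by the Iwasawa
involution `ι : T ↦ (1 + T)⁻¹ − 1` (`IwasawaAlgebra.invol`) [Greenberg 1989, pp. 101–102: "`S^ι` … the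
`Λ`-module with the same underlying set as `S` but with `Λ` acting through `ι`"; Greenberg LNM 1716 §1 p. 60].
This file supplies, for the ♯/♭ duals, exactly the dictionary the tree already has for Kato's fine dual
(`Kato2004.fineSelmerDualData_lengthAt_inv_eq`): local lengths, characteristic ideals, finiteness and
torsion of a key-`γ` datum versus a key-`γ⁻¹` datum differ by `ι` and by nothing else. It is keying-neutral
bookkeeping: it asserts nothing about which key is "print".

## What is proved

* §1 **Rigidity at ANY key `γ`** (port of `KatoFineSelmerDualUniquenessProofs`):
  `SharpFlatSelmerDualData.toDual_smul` — the `Λ`-action of ANY datum `D` read through `toDual` is the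
  canonical finite-sum action `IsLocNil.smulFun` attached to `ψ = conj_γ − 1` (induction on the nilpotence
  exponent, peeling off constant terms: `toDual_T_smul`, `toDual_C_smul`);
  `SharpFlatSelmerDualData.exists_linearEquiv` / `nonempty_linearEquiv` — two data of the same key have
  `Λ`-isomorphic modules over `toDual`; hence `lengthAt_eq`, `charIdeal_eq`, `mu_eq`, `lambda_eq`,
  `finite_iff`, `isTorsion_iff` (every invariant of `X^•` is key-determined).
* §2 **The `γ ↦ δ = γ⁻¹` re-keying is the `ι`-twist** (port of `Kato2004/IwasawaInvolutionTwistProofs` §3):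
  `sharpFlatSelmerDualData_toDual_invol_one_add_X_smul` (`ι(1 + T)` acts as `x ↦ x ∘ conj_δ` for `γ δ = 1`),
  `sharpFlatSelmerDualData_exists_involTwist` (`∃ D′` of key `δ` on the SAME character group with an
  `ι`-semilinear `e : D.X ≃+ D′.X` over `toDual`), `nonempty_sharpFlatSelmerDualData_of_mul_eq_one`.
* §3 **The dictionary, for ANY `D` of key `γ` and ANY `D′` of key `γ⁻¹`** (twist + uniqueness):
  `sharpFlatSelmerDualData_lengthAt_inv_eq` (`ℓ_𝔓(D′.X) = ℓ_{ι𝔓}(D.X)`), `…_lengthAt_eq_inv` (roles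
  exchanged), `…_charIdeal_inv_eq` (`char D′.X = ι(char D.X)`, by `Module.charIdeal_eq_map_of_semilinearEquiv`),
  `…_mem_charIdeal_inv_iff` (`f ∈ char D′.X ↔ ι f ∈ char D.X`), `…_finite_inv_iff`, `…_isTorsion_inv_iff`.

References: F. Sprung, J. Number Theory 132 (2012) Def. 7.11 (p. 1503), §2 p. 1486 ("identify
`Λ = ℤ_p[[G_∞]]` with `ℤ_p[Δ][[X]]` by sending `γ` to `1 + X`") [Sprung2012]; R. Greenberg, Adv. Stud. Pure
Math. 17 (1989) §0 pp. 101–102 [Greenberg1989]; R. Greenberg, LNM 1716 (1999) §1 p. 60 [GreenbergLNM1716];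
L. Washington, GTM 83, §13.2 [Washington1997]; J. Coates, R. Sujatha, Math. Ann. 331 (2005) §3
[CoatesSujatha2005]; tree: `IwasawaAlgebraInvolution.lean`, `IwasawaAlgebraSemilinearCharIdealProofs.lean`,
`IwasawaDualModule.lean`, `KatoFineSelmerDualUniquenessProofs.lean`, `Kato2004/IwasawaInvolutionTwistProofs.lean`.
-/

noncomputable section

open scoped Classical

universe u

namespace Literature.NumberTheory.EllipticCurves.Sprung2012

open Literature.NumberTheory.EllipticCurves Literature.NumberTheory.EllipticCurves.IwasawaAlgebra
  Literature.NumberTheory.EllipticCurves.IwasawaDual Literature.NumberTheory.EllipticCurves.Sprung2017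

variable {K : Type u} [Field K] [NumberField K] {W : WeierstrassCurve K} {p : ℕ} [Fact p.Prime]
  {κ : ZpExtension K p} {E : Type u} [Field E] [Algebra K E]
  {ι : AlgebraicClosure K →ₐ[K] AlgebraicClosure E} {ap : ℤ} {g : Field.absoluteGaloisGroup E}
  {c : ℕ → localPoints W E} {col : Chroma}

/-! ## §1 The `Λ`-action of ANY `SharpFlatSelmerDualData` is forced; uniqueness up to `Λ`-isomorphism -/

namespace SharpFlatSelmerDualData

variable {γ : Field.absoluteGaloisGroup K} (D : SharpFlatSelmerDualData W κ γ ι ap g c col)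

/-- Induction step carrier for `toDual_smul` (♯/♭ copy of
`FineSelmerDualData.toDual_smul_apply_of_pow_apply_eq_zero`): on classes `s ∈ Sel^•(E/K_∞)` killed by `ψ^N`,
`ψ = conj_γ − 1`, the action of any `SharpFlatSelmerDualData` read through `toDual` is the canonical finite
sum `IsLocNil.smulFun` (induction on `N`, peeling off the constant term `f = T · g + C(a₀)`:
`toDual_T_smul`, `toDual_C_smul` against `smulFun_X_apply`, `smulFun_C_apply`). Greenberg (1999), §1
(p. 60); Washington, §13.2. [cite: GreenbergLNM1716, §1 (p. 60)] [cite: Sprung2012, Def. 7.11 (p. 1503)] -/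
theorem toDual_smul_apply_of_pow_apply_eq_zero (N : ℕ) :
    ∀ (s : sharpFlatSelmerInfty W κ ι ap g c col),
      ((conjSharpFlatSelmerInfty W κ ι ap g c col γ - 1) ^ N) s = 0 →
      ∀ (f : IwasawaAlgebra p) (x : D.X),
        D.toDual (f • x) s =
          (isLocNil_conjSharpFlatSelmerInfty_sub_one' W κ ι ap g c col γ).smulFun f (D.toDual x) s := by
  set h := isLocNil_conjSharpFlatSelmerInfty_sub_one' W κ ι ap g c col γ
  set ψ : AddMonoid.End (sharpFlatSelmerInfty W κ ι ap g c col) :=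
    conjSharpFlatSelmerInfty W κ ι ap g c col γ - 1 with hψ
  induction N with
  | zero =>
    intro s hs f x
    rw [pow_zero, AddMonoid.End.one_apply] at hs
    rw [hs, map_zero, map_zero]
  | succ N ih =>
    intro s hs f x
    obtain ⟨k, hk⟩ := h.torsion s
    have hψs : (ψ ^ N) (ψ s) = 0 := by
      rwa [pow_succ, AddMonoid.End.coe_mul, Function.comp_apply] at hs
    -- `ψ s = conj_γ s - s` as evaluated by the additive maps `toDual y`
    have hψeval : ∀ y : D.X, D.toDual y (ψ s) =
        D.toDual y ⟨W.conjH1 p κ.kerSubgroup γ s, D.conj_mem s s.2⟩ - D.toDual y s := fun y ↦ by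
      rw [hψ, IwasawaDual.End_sub_apply, AddMonoid.End.one_apply, map_sub]
      rfl
    -- peel off the constant term
    set g' : IwasawaAlgebra p := PowerSeries.mk fun n ↦ PowerSeries.coeff (n + 1) f
    set a : ℤ_[p] := PowerSeries.constantCoeff f
    have hf : f = PowerSeries.X * g' + PowerSeries.C a := PowerSeries.eq_X_mul_shift_add_const f
    -- left-hand side
    have lhs : D.toDual (f • x) s =
        D.toDual (g' • x) (ψ s) + (PadicInt.toZModPow k a).val • D.toDual x s := by
      conv_lhs => rw [hf]
      rw [add_smul, mul_smul, map_add, AddMonoidHom.add_apply, D.toDual_T_smul,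
        D.toDual_C_smul a x s k hk, hψeval]
    -- right-hand side
    have rhs : h.smulFun f (D.toDual x) s =
        h.smulFun g' (D.toDual x) (ψ s) + (PadicInt.toZModPow k a).val • D.toDual x s := by
      conv_lhs => rw [hf]
      rw [h.smulFun_add_left, h.smulFun_mul_left, AddMonoidHom.add_apply, h.smulFun_X_apply,
        h.smulFun_C_apply a (D.toDual x) hk]
    rw [lhs, rhs, ih (ψ s) hψs g' x]

/-- **The `Λ`-action of a `SharpFlatSelmerDualData` is forced, for ANY key `γ`.** For any datum `D` of
`X^•(E/K_∞)` and all `f ∈ Λ`, `x ∈ X^•`: `toDual (f • x) = f ⋆ toDual x`, where `⋆` is the canonical action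
`IsLocNil.smulFun` of `Λ` on `Hom(Sel^•(E/K_∞), ℚ/ℤ)` attached to `ψ = conj_γ − 1` — because every
`s ∈ Sel^•(E/K_∞)` is killed by a power of `p` and by a power of `ψ`
(`isLocNil_conjSharpFlatSelmerInfty_sub_one'`). ♯/♭ copy of `FineSelmerDualData.toDual_smul`; the Summits-side
`…FlatDualRestriction.sharpFlatDual_toDual_smul` is the case `ap = 0`, `• = ♭`.
[cite: GreenbergLNM1716, §1 (p. 60)] [cite: Sprung2012, Def. 7.11 (p. 1503)] -/
theorem toDual_smul (f : IwasawaAlgebra p) (x : D.X) :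
    D.toDual (f • x) =
      (isLocNil_conjSharpFlatSelmerInfty_sub_one' W κ ι ap g c col γ).smulFun f (D.toDual x) := by
  ext s
  obtain ⟨N, hN⟩ := (isLocNil_conjSharpFlatSelmerInfty_sub_one' W κ ι ap g c col γ).nil s
  exact D.toDual_smul_apply_of_pow_apply_eq_zero N s hN f x

/-- **Uniqueness of the ♯/♭ dual datum, for ANY key `γ`.** The comparison isomorphism
`toDual'⁻¹ ∘ toDual : D.X ≃ₗ[Λ] D'.X` between two data of `X^•(E/K_∞)` for the same
`(W, κ, γ, ι, ap, g, c, •)` exists and commutes with the identifications with `Hom(Sel^•(E/K_∞), ℚ/ℤ)`: a group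
isomorphism (both `toDual`s are bijective), `Λ`-linear because both actions read through `toDual` are the
canonical one (`toDual_smul`). ♯/♭ copy of `FineSelmerDualData.exists_linearEquiv`. Stated as an existence
theorem (no definition introduced). [cite: GreenbergLNM1716, §1 (p. 60)] [cite: Sprung2012, Def. 7.11 (p. 1503)] -/
theorem exists_linearEquiv (D D' : SharpFlatSelmerDualData W κ γ ι ap g c col) :
    ∃ e : D.X ≃ₗ[IwasawaAlgebra p] D'.X, ∀ x, D'.toDual (e x) = D.toDual x := by
  set eD := AddEquiv.ofBijective D.toDual D.bijective with heD
  set eD' := AddEquiv.ofBijective D'.toDual D'.bijective with heD'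
  have h1 : ∀ χ, D'.toDual (eD'.symm χ) = χ := fun χ ↦ eD'.apply_symm_apply χ
  have h2 : ∀ χ, D.toDual (eD.symm χ) = χ := fun χ ↦ eD.apply_symm_apply χ
  refine ⟨{ toFun := fun x ↦ eD'.symm (D.toDual x)
            invFun := fun x' ↦ eD.symm (D'.toDual x')
            map_add' := fun x y ↦ by rw [map_add, map_add]
            map_smul' := fun f x ↦ ?_
            left_inv := fun x ↦ ?_
            right_inv := fun x' ↦ ?_ }, fun x ↦ h1 _⟩
  · apply D'.bijective.injective
    rw [RingHom.id_apply, h1, D'.toDual_smul, h1, D.toDual_smul]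
  · apply D.bijective.injective
    rw [h2, h1]
  · apply D'.bijective.injective
    rw [h1, h2]

/-- **Any two ♯/♭ dual data for the same key have `Λ`-isomorphic modules** (the `Nonempty` form of
`exists_linearEquiv`; any key `γ`). [cite: GreenbergLNM1716, §1 (p. 60)] [cite: Sprung2012, Def. 7.11 (p. 1503)] -/
theorem nonempty_linearEquiv (D D' : SharpFlatSelmerDualData W κ γ ι ap g c col) :
    Nonempty (D.X ≃ₗ[IwasawaAlgebra p] D'.X) :=
  let ⟨e, _⟩ := exists_linearEquiv D D'
  ⟨e⟩

/-- Local lengths of `X^•(E/K_∞)` are key-determined: `ℓ_𝔓(D.X) = ℓ_𝔓(D'.X)` for any two data of the same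
key. [cite: GreenbergLNM1716, §1 (p. 60)] [cite: BourbakiAC5to7, Ch. VII §4.4] -/
theorem lengthAt_eq (D D' : SharpFlatSelmerDualData W κ γ ι ap g c col)
    (𝔓 : PrimeSpectrum (IwasawaAlgebra p)) :
    Module.lengthAt (IwasawaAlgebra p) D.X 𝔓 = Module.lengthAt (IwasawaAlgebra p) D'.X 𝔓 := by
  obtain ⟨e⟩ := nonempty_linearEquiv D D'
  exact Module.lengthAt_eq_of_linearEquiv e 𝔓

/-- The characteristic ideal of `X^•(E/K_∞)` is key-determined: `char D.X = char D'.X` for any two data of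
the same key. [cite: GreenbergLNM1716, §1 (p. 60)] [cite: BourbakiAC5to7, Ch. VII §4.5] -/
theorem charIdeal_eq (D D' : SharpFlatSelmerDualData W κ γ ι ap g c col) :
    D.charIdeal = D'.charIdeal := by
  obtain ⟨e⟩ := nonempty_linearEquiv D D'
  exact Module.charIdeal_eq_of_linearEquiv e

/-- The `μ`-invariant of `X^•(E/K_∞)` is key-determined. [cite: Washington1997, §13.2] -/
theorem mu_eq (D D' : SharpFlatSelmerDualData W κ γ ι ap g c col) : D.mu = D'.mu := by
  obtain ⟨e⟩ := nonempty_linearEquiv D D'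
  exact muInvariant_eq_of_linearEquiv e

/-- The `λ`-invariant of `X^•(E/K_∞)` is key-determined. [cite: Washington1997, §13.2] -/
theorem lambda_eq (D D' : SharpFlatSelmerDualData W κ γ ι ap g c col) : D.lambda = D'.lambda := by
  obtain ⟨e⟩ := nonempty_linearEquiv D D'
  exact lambdaInvariant_eq_of_linearEquiv e

/-- Finite generation of `X^•(E/K_∞)` is key-determined. [cite: GreenbergLNM1716, §1 (p. 60)] -/
theorem finite_iff (D D' : SharpFlatSelmerDualData W κ γ ι ap g c col) :
    Module.Finite (IwasawaAlgebra p) D.X ↔ Module.Finite (IwasawaAlgebra p) D'.X := by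
  obtain ⟨e⟩ := nonempty_linearEquiv D D'
  exact ⟨fun _ ↦ Module.Finite.equiv e, fun _ ↦ Module.Finite.equiv e.symm⟩

/-- `Λ`-torsionness of `X^•(E/K_∞)` is key-determined. [cite: GreenbergLNM1716, §1 (p. 60)] -/
theorem isTorsion_iff (D D' : SharpFlatSelmerDualData W κ γ ι ap g c col) :
    Module.IsTorsion (IwasawaAlgebra p) D.X ↔ Module.IsTorsion (IwasawaAlgebra p) D'.X := by
  obtain ⟨e⟩ := nonempty_linearEquiv D D'
  -- a torsion module surjects only onto torsion modules (both directions along `e`)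
  have key : ∀ {M M'' : Type u} [AddCommGroup M] [Module (IwasawaAlgebra p) M] [AddCommGroup M'']
      [Module (IwasawaAlgebra p) M''] (φ : M →ₗ[IwasawaAlgebra p] M''), Function.Surjective φ →
      Module.IsTorsion (IwasawaAlgebra p) M → Module.IsTorsion (IwasawaAlgebra p) M'' := by
    intro M M'' _ _ _ _ φ hφ hM x
    obtain ⟨y, rfl⟩ := hφ x
    obtain ⟨a, ha⟩ := @hM y
    refine ⟨a, ?_⟩
    rw [Submonoid.smul_def, ← map_smul, ← Submonoid.smul_def, ha, map_zero]
  exact ⟨key e.toLinearMap e.surjective, key e.symm.toLinearMap e.symm.surjective⟩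

end SharpFlatSelmerDualData

/-! ## §2 The `γ ↦ δ = γ⁻¹` re-keying of a ♯/♭ dual datum is its `ι`-twist -/

section Twist

variable {γ δ : Field.absoluteGaloisGroup K}

/-- In `D : SharpFlatSelmerDualData W κ γ …` the unit `ι(1 + T)` acts as `x ↦ x ∘ conj_δ` for `γ δ = 1`
(`(1 + T)` acts as `x ↦ x ∘ conj_γ` and `conj` is an action). ♯/♭ copy of
`Kato2004.fineSelmerDualData_toDual_invol_one_add_X_smul`. [cite: GreenbergLNM1716, §1 (p. 60)]
[cite: Sprung2012, Def. 7.11 (p. 1503)] -/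
theorem sharpFlatSelmerDualData_toDual_invol_one_add_X_smul (hγδ : γ * δ = 1)
    (D : SharpFlatSelmerDualData W κ γ ι ap g c col) (x : D.X)
    (s : sharpFlatSelmerInfty W κ ι ap g c col) :
    D.toDual (invol p (1 + PowerSeries.X) • x) s =
      D.toDual x ⟨W.conjH1 p κ.kerSubgroup δ s,
        conjH1_mem_sharpFlatSelmerInfty W κ ι ap g c col δ s.2⟩ := by
  set y : D.X := invol p (1 + PowerSeries.X) • x with hy
  have hx : x = (1 + PowerSeries.X : IwasawaAlgebra p) • y := by
    rw [hy, ← mul_smul, one_add_X_mul_invol_one_add_X p, one_smul]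
  have h1 : ∀ s' : sharpFlatSelmerInfty W κ ι ap g c col,
      D.toDual ((1 + PowerSeries.X : IwasawaAlgebra p) • y) s' =
        D.toDual y ⟨W.conjH1 p κ.kerSubgroup γ s', D.conj_mem s' s'.2⟩ := by
    intro s'
    rw [add_smul, one_smul, map_add, AddMonoidHom.add_apply, D.toDual_T_smul, add_sub_cancel]
  conv_rhs => rw [hx, h1]
  congr 1
  apply Subtype.ext
  change (s : W.subgroupH1 p κ.kerSubgroup) =
    W.conjH1 p κ.kerSubgroup γ (W.conjH1 p κ.kerSubgroup δ (s : W.subgroupH1 p κ.kerSubgroup))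
  rw [← AddMonoidHom.comp_apply, ← W.conjH1_mul_holds p κ.kerSubgroup γ δ, hγδ,
    W.conjH1_one_holds p κ.kerSubgroup, AddMonoidHom.id_apply]

/-- **The `γ ↦ δ = γ⁻¹` re-keying of a ♯/♭ dual datum is its `ι`-twist**: for `γ δ = 1` and
`D : SharpFlatSelmerDualData W κ γ ι ap g c •` there is `D′ : SharpFlatSelmerDualData W κ δ ι ap g c •` on
the SAME character group `Hom(Sel^•(E/K_∞), ℚ/ℤ)` (same `X`, same `toDual`) with the `Λ`-structure twisted by
`ι` — an `ι`-semilinear `e : D.X ≃+ D′.X` over `toDual` ("`D′ = D^ι`": Greenberg's "`S^ι` … the `Λ`-module with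
the same underlying set as `S` but with `Λ` acting through `ι`"). ♯/♭ copy of
`Kato2004.fineSelmerDualData_exists_involTwist`. [cite: Greenberg1989, §0 pp. 101–102]
[cite: GreenbergLNM1716, §1 (p. 60)] [cite: Sprung2012, Def. 7.11 (p. 1503)] -/
theorem sharpFlatSelmerDualData_exists_involTwist (hγδ : γ * δ = 1)
    (D : SharpFlatSelmerDualData W κ γ ι ap g c col) :
    ∃ (D' : SharpFlatSelmerDualData W κ δ ι ap g c col) (e : D.X ≃+ D'.X),
      (∀ (f : IwasawaAlgebra p) (x : D.X), e (f • x) = invol p f • e x) ∧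
      ∀ x : D.X, D'.toDual (e x) = D.toDual x := by
  refine ⟨@SharpFlatSelmerDualData.mk K _ _ p _ W κ δ E _ _ ι ap g c col D.X D.addCommGroup
      (Module.compHom D.X (invol p).toRingHom)
      (fun s hs ↦ conjH1_mem_sharpFlatSelmerInfty W κ ι ap g c col δ hs) D.toDual D.bijective ?_ ?_,
    AddEquiv.refl D.X, ?_, ?_⟩
  · intro x s
    change D.toDual (invol p PowerSeries.X • x) s = _
    have hX : invol p (PowerSeries.X : IwasawaAlgebra p) = invol p (1 + PowerSeries.X) - 1 := by
      rw [map_add, map_one, add_sub_cancel_left]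
    rw [hX, sub_smul, one_smul, map_sub, AddMonoidHom.sub_apply,
      sharpFlatSelmerDualData_toDual_invol_one_add_X_smul hγδ D x s]
  · intro a x s k hk
    change D.toDual (invol p (PowerSeries.C a) • x) s = _
    rw [invol_C]
    exact D.toDual_C_smul a x s k hk
  · intro f x
    change f • x = invol p (invol p f) • x
    rw [invol_invol]
  · intro x
    rfl

/-- **Existence transported along the re-keying**: `SharpFlatSelmerDualData W κ δ ι ap g c •` is inhabited as
soon as the key-`γ` type is, for `γ δ = 1` (of course both are inhabited outright,
`nonempty_sharpFlatSelmerDualData'`; this form records that the twist of a GIVEN datum is a datum).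
[cite: GreenbergLNM1716, §1 (p. 60)] [cite: Sprung2012, Def. 7.11 (p. 1503)] -/
theorem nonempty_sharpFlatSelmerDualData_of_mul_eq_one (hγδ : γ * δ = 1)
    (D : SharpFlatSelmerDualData W κ γ ι ap g c col) :
    Nonempty (SharpFlatSelmerDualData W κ δ ι ap g c col) :=
  let ⟨D', _⟩ := sharpFlatSelmerDualData_exists_involTwist hγδ D
  ⟨D'⟩

end Twist

/-! ## §3 The dictionary between a key-`γ` datum and a key-`γ⁻¹` datum (any two) -/

section Dictionary

variable {γ : Field.absoluteGaloisGroup K}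

/-- **`ℓ_𝔓(D′) = ℓ_{ι𝔓}(D)` for ANY ♯/♭ dual data `D` of key `γ` and `D′` of key `γ⁻¹`** — the ♯/♭ twin
(H1a of the `SprungLowerDivisibilityAtThree` crux dossier) of `Kato2004.fineSelmerDualData_lengthAt_inv_eq`:
the twisted datum of `sharpFlatSelmerDualData_exists_involTwist` has these lengths by
`Kato2004.lengthAt_eq_of_involSemilinear`, and any two data of key `γ⁻¹` are `Λ`-isomorphic
(`SharpFlatSelmerDualData.nonempty_linearEquiv`). Here `ι𝔓 := PrimeSpectrum.comap (invol p) 𝔓` (a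
height-one prime iff `𝔓` is, `Kato2004.height_comap_invol`). With `D` the tree-keyed `X^•` (key `γ`,
`1 + T ↦ x ∘ conj_γ`) and `D′` the contragredient (print) `X^•` of Sprung's Thm. 7.14 / Conj. 7.21.
[cite: GreenbergLNM1716, §1 (p. 60)] [cite: Greenberg1989, §0 pp. 101–102] [cite: Sprung2012, Def. 7.11 (p. 1503)] -/
theorem sharpFlatSelmerDualData_lengthAt_inv_eq (D : SharpFlatSelmerDualData W κ γ ι ap g c col)
    (D' : SharpFlatSelmerDualData W κ γ⁻¹ ι ap g c col) (𝔓 : PrimeSpectrum (IwasawaAlgebra p)) :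
    Module.lengthAt (IwasawaAlgebra p) D'.X 𝔓 =
      Module.lengthAt (IwasawaAlgebra p) D.X (PrimeSpectrum.comap (invol p).toRingHom 𝔓) := by
  obtain ⟨D₁, e, he, -⟩ := sharpFlatSelmerDualData_exists_involTwist (mul_inv_cancel γ) D
  obtain ⟨e'⟩ := SharpFlatSelmerDualData.nonempty_linearEquiv D' D₁
  rw [Module.lengthAt_eq_of_linearEquiv e' 𝔓, Kato2004.lengthAt_eq_of_involSemilinear e he 𝔓]

/-- The same with the roles exchanged: `ℓ_𝔓(D) = ℓ_{ι𝔓}(D′)` for `D` of key `γ`, `D′` of key `γ⁻¹`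
(`ι(ι𝔓) = 𝔓`). [cite: GreenbergLNM1716, §1 (p. 60)] [cite: Sprung2012, Def. 7.11 (p. 1503)] -/
theorem sharpFlatSelmerDualData_lengthAt_eq_inv (D : SharpFlatSelmerDualData W κ γ ι ap g c col)
    (D' : SharpFlatSelmerDualData W κ γ⁻¹ ι ap g c col) (𝔓 : PrimeSpectrum (IwasawaAlgebra p)) :
    Module.lengthAt (IwasawaAlgebra p) D.X 𝔓 =
      Module.lengthAt (IwasawaAlgebra p) D'.X (PrimeSpectrum.comap (invol p).toRingHom 𝔓) := by
  rw [sharpFlatSelmerDualData_lengthAt_inv_eq D D', Kato2004.comap_invol_comap_invol]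

/-- **`char(D′.X) = ι(char(D.X))`** for ANY `D` of key `γ` and `D′` of key `γ⁻¹`: the characteristic ideal of
the contragredient ♯/♭ dual is the `ι`-image of that of the tree-keyed one ("`Char(M^ι) = ι(Char M)`",
`Module.charIdeal_eq_map_of_semilinearEquiv` for the ring automorphism `involEquiv p`, plus uniqueness at key
`γ⁻¹`). [cite: GreenbergLNM1716, §1 (p. 60)] [cite: Washington1997, §13.2] [cite: Sprung2012, Def. 7.11 (p. 1503)] -/
theorem sharpFlatSelmerDualData_charIdeal_inv_eq (D : SharpFlatSelmerDualData W κ γ ι ap g c col)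
    (D' : SharpFlatSelmerDualData W κ γ⁻¹ ι ap g c col) :
    D'.charIdeal = D.charIdeal.map (invol p).toRingHom := by
  obtain ⟨D₁, e, he, -⟩ := sharpFlatSelmerDualData_exists_involTwist (mul_inv_cancel γ) D
  rw [SharpFlatSelmerDualData.charIdeal_eq D' D₁]
  have h := Module.charIdeal_eq_map_of_semilinearEquiv
    (involEquiv p : IwasawaAlgebra p ≃+* IwasawaAlgebra p) e (fun r m ↦ he r m)
  exact h

/-- Membership form of the characteristic-ideal dictionary: **`f ∈ char(D′.X) ↔ ι f ∈ char(D.X)`** for `D`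
of key `γ`, `D′` of key `γ⁻¹` (`ι` is an involution, so `map ι = comap ι`). In particular
`L ∈ char(D′.X) ↔ ι L ∈ char(D.X)`: a divisibility "`char X^• ∣ …`" or "`… ∣ char X^•`" stated for the
tree-keyed datum reads, for the contragredient one, with `ι` applied to the other side.
[cite: GreenbergLNM1716, §1 (p. 60)] [cite: Washington1997, §13.2] -/
theorem sharpFlatSelmerDualData_mem_charIdeal_inv_iff (D : SharpFlatSelmerDualData W κ γ ι ap g c col)
    (D' : SharpFlatSelmerDualData W κ γ⁻¹ ι ap g c col) (f : IwasawaAlgebra p) :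
    f ∈ D'.charIdeal ↔ invol p f ∈ D.charIdeal := by
  rw [sharpFlatSelmerDualData_charIdeal_inv_eq D D']
  have hmap : D.charIdeal.map (invol p).toRingHom =
      D.charIdeal.comap (invol p).toRingHom := by
    have h1 : D.charIdeal.map ((involEquiv p : IwasawaAlgebra p ≃+* IwasawaAlgebra p) :
        IwasawaAlgebra p →+* IwasawaAlgebra p) =
        D.charIdeal.comap ((involEquiv p).symm : IwasawaAlgebra p ≃+* IwasawaAlgebra p) :=
      Ideal.map_comap_of_equiv _
    exact h1
  rw [hmap, Ideal.mem_comap]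
  rfl

/-- The same dictionary read from the other side: **`f ∈ char(D.X) ↔ ι f ∈ char(D′.X)`**.
[cite: GreenbergLNM1716, §1 (p. 60)] [cite: Washington1997, §13.2] -/
theorem sharpFlatSelmerDualData_mem_charIdeal_iff_inv (D : SharpFlatSelmerDualData W κ γ ι ap g c col)
    (D' : SharpFlatSelmerDualData W κ γ⁻¹ ι ap g c col) (f : IwasawaAlgebra p) :
    f ∈ D.charIdeal ↔ invol p f ∈ D'.charIdeal := by
  rw [sharpFlatSelmerDualData_mem_charIdeal_inv_iff D D', invol_invol]

/-- Finite generation is insensitive to the re-keying: `D.X` f.g. ↔ `D′.X` f.g. for `D` of key `γ`, `D′` of key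
`γ⁻¹`. [cite: GreenbergLNM1716, §1 (p. 60)] [cite: Washington1997, §13.2] -/
theorem sharpFlatSelmerDualData_finite_inv_iff (D : SharpFlatSelmerDualData W κ γ ι ap g c col)
    (D' : SharpFlatSelmerDualData W κ γ⁻¹ ι ap g c col) :
    Module.Finite (IwasawaAlgebra p) D.X ↔ Module.Finite (IwasawaAlgebra p) D'.X := by
  obtain ⟨D₁, e, he, -⟩ := sharpFlatSelmerDualData_exists_involTwist (mul_inv_cancel γ) D
  obtain ⟨D₂, e₂, he₂, -⟩ := sharpFlatSelmerDualData_exists_involTwist (inv_mul_cancel γ) D'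
  rw [SharpFlatSelmerDualData.finite_iff D' D₁]
  refine ⟨fun _ ↦ Kato2004.finite_of_involSemilinear e he, fun hD₁ ↦ ?_⟩
  rw [SharpFlatSelmerDualData.finite_iff D D₂]
  haveI : Module.Finite (IwasawaAlgebra p) D'.X := (SharpFlatSelmerDualData.finite_iff D' D₁).2 hD₁
  exact Kato2004.finite_of_involSemilinear e₂ he₂

/-- `Λ`-torsionness is insensitive to the re-keying: `D.X` torsion ↔ `D′.X` torsion for `D` of key `γ`, `D′`
of key `γ⁻¹` (Sprung's Thm. 7.14 "finitely generated torsion" is the same statement in either keying).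
[cite: GreenbergLNM1716, §1 (p. 60)] [cite: Sprung2012, Thm. 7.14 (p. 1504) (the property only)] -/
theorem sharpFlatSelmerDualData_isTorsion_inv_iff (D : SharpFlatSelmerDualData W κ γ ι ap g c col)
    (D' : SharpFlatSelmerDualData W κ γ⁻¹ ι ap g c col) :
    Module.IsTorsion (IwasawaAlgebra p) D.X ↔ Module.IsTorsion (IwasawaAlgebra p) D'.X := by
  obtain ⟨D₁, e, he, -⟩ := sharpFlatSelmerDualData_exists_involTwist (mul_inv_cancel γ) D
  obtain ⟨D₂, e₂, he₂, -⟩ := sharpFlatSelmerDualData_exists_involTwist (inv_mul_cancel γ) D'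
  rw [SharpFlatSelmerDualData.isTorsion_iff D' D₁]
  refine ⟨fun h ↦ Kato2004.isTorsion_of_involSemilinear h e he, fun hD₁ ↦ ?_⟩
  rw [SharpFlatSelmerDualData.isTorsion_iff D D₂]
  exact Kato2004.isTorsion_of_involSemilinear
    ((SharpFlatSelmerDualData.isTorsion_iff D' D₁).2 hD₁) e₂ he₂

/-- **Route-shaped instance over `ℚ`** (the binder shape of `Theorems.SprungSharpFlatLowerDivisibility` /
`SprungSharpFlatMainConjecture` and of `Sprung2012.thm716_sharpFlatCharIdeal_divisibility`:
`ι = closureEmb (v.adicCompletion ℚ)`, `ap = a_p(W)`): for every tree-keyed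
`D : SharpFlatSelmerDualData W κ γ (closureEmb …) (W.frobeniusTrace p) g c •` and every contragredient
`D′ : SharpFlatSelmerDualData W κ γ⁻¹ (closureEmb …) (W.frobeniusTrace p) g c •`, at every prime `𝔓`:
`ℓ_𝔓(D.X) = ℓ_{ι𝔓}(D′.X)` and `f ∈ char D.X ↔ ι f ∈ char D′.X`.
[cite: GreenbergLNM1716, §1 (p. 60)] [cite: Sprung2012, Def. 7.11 (p. 1503)] -/
theorem sharpFlatSelmerDualData_dictionary_rat (W : WeierstrassCurve ℚ) [W.IsGloballyMinimal] {p : ℕ}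
    [Fact p.Prime] (κ : ZpExtension ℚ p) (γ : Field.absoluteGaloisGroup ℚ)
    (v : IsDedekindDomain.HeightOneSpectrum (NumberField.RingOfIntegers ℚ))
    (g : Field.absoluteGaloisGroup (v.adicCompletion ℚ)) (c : ℕ → localPoints W (v.adicCompletion ℚ))
    (col : Chroma)
    (D : SharpFlatSelmerDualData W κ γ (closureEmb (K := ℚ) (v.adicCompletion ℚ))
      (W.frobeniusTrace p) g c col)
    (D' : SharpFlatSelmerDualData W κ γ⁻¹ (closureEmb (K := ℚ) (v.adicCompletion ℚ))
      (W.frobeniusTrace p) g c col) :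
    (∀ 𝔓 : PrimeSpectrum (IwasawaAlgebra p),
      Module.lengthAt (IwasawaAlgebra p) D.X 𝔓 =
        Module.lengthAt (IwasawaAlgebra p) D'.X (PrimeSpectrum.comap (invol p).toRingHom 𝔓)) ∧
    ∀ f : IwasawaAlgebra p, f ∈ D.charIdeal ↔ invol p f ∈ D'.charIdeal :=
  ⟨fun 𝔓 ↦ sharpFlatSelmerDualData_lengthAt_eq_inv D D' 𝔓,
    fun f ↦ sharpFlatSelmerDualData_mem_charIdeal_iff_inv D D' f⟩

end Dictionary

/-! ## §4 APPEND (same seat, 2026-08-28): the KEYING-IMMUNE invariants — `μ`, `λ`, the lengths at `ι`-fixed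
primes — and the `pⁿ`-twisted membership door used by Sprung's Thm. 7.16 (`pⁿ L^• ∈ char X^•`)

On top of `IwasawaAlgebraInvolutionInvariantsProofs.lean` (generic: `μ(M^ι) = μ(M)`, `λ(M^ι) = λ(M)`, lengths at
`ι`-fixed primes). For ANY `D` of key `γ` and ANY `D′` of key `γ⁻¹`: `D′.mu = D.mu`, `D′.lambda = D.lambda`,
`ℓ_𝔓(D′.X) = ℓ_𝔓(D.X)` whenever `ι𝔓 = 𝔓` (so at `(T)`, at `(p)`, and — by
`Summit….ChromaticCommonZeros.comap_invol_eq_self_of_cyclotomic_comp_mem`, Summits side — at every positive-level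
cyclotomic prime); and `pⁿ L ∈ char D′.X ↔ pⁿ ι L ∈ char D.X`. Statements about `X^•` that mention only these
quantities are the SAME in either keying. -/

section KeyingImmune

variable {γ : Field.absoluteGaloisGroup K}

/-- **At an `ι`-fixed prime the two keyings have the same local length**: `ι𝔓 = 𝔓 ⟹ ℓ_𝔓(D′.X) = ℓ_𝔓(D.X)`
for `D` of key `γ`, `D′` of key `γ⁻¹`. [cite: GreenbergLNM1716, §1 (p. 60)] [cite: Washington1997, §13.2] -/
theorem sharpFlatSelmerDualData_lengthAt_inv_eq_of_comap_invol_eq (D : SharpFlatSelmerDualData W κ γ ι ap g c col)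
    (D' : SharpFlatSelmerDualData W κ γ⁻¹ ι ap g c col) (𝔓 : PrimeSpectrum (IwasawaAlgebra p))
    (h𝔓 : PrimeSpectrum.comap (invol p).toRingHom 𝔓 = 𝔓) :
    Module.lengthAt (IwasawaAlgebra p) D'.X 𝔓 = Module.lengthAt (IwasawaAlgebra p) D.X 𝔓 := by
  rw [sharpFlatSelmerDualData_lengthAt_inv_eq D D' 𝔓, h𝔓]

/-- The two keyings have the same length at the augmentation prime `(T)` (orders of vanishing at `T = 0`, i.e. the
rank / leading-term bookkeeping of descent to `K`, are keying-insensitive). [cite: Washington1997, §13.2]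
[cite: MazurTateTeitelbaum1986Invent, Ch. I §17] -/
theorem sharpFlatSelmerDualData_lengthAt_primeT_inv_eq (D : SharpFlatSelmerDualData W κ γ ι ap g c col)
    (D' : SharpFlatSelmerDualData W κ γ⁻¹ ι ap g c col) :
    Module.lengthAt (IwasawaAlgebra p) D'.X (primeT p) = Module.lengthAt (IwasawaAlgebra p) D.X (primeT p) :=
  sharpFlatSelmerDualData_lengthAt_inv_eq_of_comap_invol_eq D D' (primeT p) (comap_invol_primeT p)

/-- The two keyings have the same length at the prime `(p)`. [cite: Washington1997, §13.2] -/
theorem sharpFlatSelmerDualData_lengthAt_inv_eq_of_asIdeal_eq_augIdealP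
    (D : SharpFlatSelmerDualData W κ γ ι ap g c col) (D' : SharpFlatSelmerDualData W κ γ⁻¹ ι ap g c col)
    (𝔓 : PrimeSpectrum (IwasawaAlgebra p)) (h𝔓 : 𝔓.asIdeal = augIdealP p) :
    Module.lengthAt (IwasawaAlgebra p) D'.X 𝔓 = Module.lengthAt (IwasawaAlgebra p) D.X 𝔓 :=
  sharpFlatSelmerDualData_lengthAt_inv_eq_of_comap_invol_eq D D' 𝔓
    (comap_invol_eq_self_of_asIdeal_eq_augIdealP p 𝔓 h𝔓)

/-- **`μ(X^•)` is keying-immune**: `D′.mu = D.mu` for ANY `D` of key `γ` and `D′` of key `γ⁻¹` (twist +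
uniqueness + `muInvariant_eq_of_involSemilinear`). [cite: Washington1997, §13.2] [cite: Sprung2012, Thm. 7.14 (the invariants only)] -/
theorem sharpFlatSelmerDualData_mu_inv_eq (D : SharpFlatSelmerDualData W κ γ ι ap g c col)
    (D' : SharpFlatSelmerDualData W κ γ⁻¹ ι ap g c col) : D'.mu = D.mu := by
  obtain ⟨D₁, e, he, -⟩ := sharpFlatSelmerDualData_exists_involTwist (mul_inv_cancel γ) D
  rw [SharpFlatSelmerDualData.mu_eq D' D₁]
  exact muInvariant_eq_of_involSemilinear e he

/-- **`λ(X^•)` is keying-immune**: `D′.lambda = D.lambda` for ANY `D` of key `γ` and `D′` of key `γ⁻¹` (twist +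
uniqueness + `lambdaInvariant_eq_of_involSemilinear`). [cite: Washington1997, §13.2] [cite: Sprung2012, Thm. 7.14 (the invariants only)] -/
theorem sharpFlatSelmerDualData_lambda_inv_eq (D : SharpFlatSelmerDualData W κ γ ι ap g c col)
    (D' : SharpFlatSelmerDualData W κ γ⁻¹ ι ap g c col) : D'.lambda = D.lambda := by
  obtain ⟨D₁, e, he, -⟩ := sharpFlatSelmerDualData_exists_involTwist (mul_inv_cancel γ) D
  rw [SharpFlatSelmerDualData.lambda_eq D' D₁]
  exact lambdaInvariant_eq_of_involSemilinear e he

/-- `ι L ∈ char(D′.X) ↔ L ∈ char(D.X)` (the membership dictionary with `ι` moved to the contragredient side).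
[cite: GreenbergLNM1716, §1 (p. 60)] -/
theorem sharpFlatSelmerDualData_invol_mem_charIdeal_inv_iff (D : SharpFlatSelmerDualData W κ γ ι ap g c col)
    (D' : SharpFlatSelmerDualData W κ γ⁻¹ ι ap g c col) (f : IwasawaAlgebra p) :
    invol p f ∈ D'.charIdeal ↔ f ∈ D.charIdeal := by
  rw [sharpFlatSelmerDualData_mem_charIdeal_inv_iff D D', invol_invol]

/-- **The `pⁿ`-twisted membership door** (the shape of Sprung's Thm. 7.16 / Kato's divisibility `pⁿ L^• ∈ char X^•`):
`pⁿ · L ∈ char(D′.X) ↔ pⁿ · ι L ∈ char(D.X)` for `D` of key `γ`, `D′` of key `γ⁻¹` (`ι` fixes the constant `p`).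
So the typed (key-`γ`) reading of Thm. 7.16 and its contragredient (print) reading differ exactly by `L ↔ ι L`.
[cite: Sprung2012, Thm. 7.16 (p. 1504) (the shape only)] [cite: GreenbergLNM1716, §1 (p. 60)] -/
theorem sharpFlatSelmerDualData_natCast_pow_mul_mem_charIdeal_inv_iff
    (D : SharpFlatSelmerDualData W κ γ ι ap g c col) (D' : SharpFlatSelmerDualData W κ γ⁻¹ ι ap g c col)
    (n : ℕ) (L : IwasawaAlgebra p) :
    (p : IwasawaAlgebra p) ^ n * L ∈ D'.charIdeal ↔ (p : IwasawaAlgebra p) ^ n * invol p L ∈ D.charIdeal := by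
  rw [sharpFlatSelmerDualData_mem_charIdeal_inv_iff D D', map_mul, map_pow, map_natCast]

/-- `∃ n, pⁿ · L ∈ char(D′.X) ↔ ∃ n, pⁿ · ι L ∈ char(D.X)` (the `∃ n` form in which Thm. 7.16 is typed).
[cite: Sprung2012, Thm. 7.16 (p. 1504) (the shape only)] [cite: GreenbergLNM1716, §1 (p. 60)] -/
theorem sharpFlatSelmerDualData_exists_natCast_pow_mul_mem_charIdeal_inv_iff
    (D : SharpFlatSelmerDualData W κ γ ι ap g c col) (D' : SharpFlatSelmerDualData W κ γ⁻¹ ι ap g c col)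
    (L : IwasawaAlgebra p) :
    (∃ n : ℕ, (p : IwasawaAlgebra p) ^ n * L ∈ D'.charIdeal) ↔
      ∃ n : ℕ, (p : IwasawaAlgebra p) ^ n * invol p L ∈ D.charIdeal :=
  exists_congr fun n ↦ sharpFlatSelmerDualData_natCast_pow_mul_mem_charIdeal_inv_iff D D' n L

/-- The same door read from the tree-keyed side: `∃ n, pⁿ · L ∈ char(D.X) ↔ ∃ n, pⁿ · ι L ∈ char(D′.X)`.
[cite: Sprung2012, Thm. 7.16 (p. 1504) (the shape only)] [cite: GreenbergLNM1716, §1 (p. 60)] -/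
theorem sharpFlatSelmerDualData_exists_natCast_pow_mul_mem_charIdeal_iff_inv
    (D : SharpFlatSelmerDualData W κ γ ι ap g c col) (D' : SharpFlatSelmerDualData W κ γ⁻¹ ι ap g c col)
    (L : IwasawaAlgebra p) :
    (∃ n : ℕ, (p : IwasawaAlgebra p) ^ n * L ∈ D.charIdeal) ↔
      ∃ n : ℕ, (p : IwasawaAlgebra p) ^ n * invol p L ∈ D'.charIdeal := by
  rw [sharpFlatSelmerDualData_exists_natCast_pow_mul_mem_charIdeal_inv_iff D D', invol_invol]

end KeyingImmune

end Literature.NumberTheory.EllipticCurves.Sprung2012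

end
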